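import Mathlib
import HarnessLib
import Literature.MathematicalPhysics.KineticTheory.VelocityFlipNoise
import Summits.AtomisticToContinuum.FouriersLaw.Theorems.JunctionLocalitySuperadditiveResistanceKuboPlain
import Summits.AtomisticToContinuum.FouriersLaw.Theorems.JunctionLocalityConductanceLowerBoundStubRowSum

/-!
# Flip forward fields are plain forward pairs: the flip Dirichlet form and the energy row sum at every flip rate

`--supports stmt-AtomisticToContinuum-11976` helper file (crux `VanishingNoiseBound`, route
`VanishingNoiseTransfer`, line `fekete-usc-one-length`, stub S3 `stub_noisyPositiveConductance`, wave 3).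
The SIGN half of the finite-volume Green–Kubo formula for the velocity-flip chain, in forward-field form.

Setting: the pinned anharmonic chain `pinnedChain ω₂ lam β γ` (all parameters `> 0`), `T > 0`, `L ≥ 2`,
a flip rate `ε ≥ 0`, and a classical FORWARD FIELD of the LEFT bath for the flip-noisy equilibrium generator
`L_{T,T} + εS` (`OscillatorChain.flipGenerator`, `S = flipNoise` = Bernardin–Olla's velocity flips at every
site): `g ∈ C² ∩ L²(μ_T)` with `(L_{T,T} + εS) g = −(p_0² − T)` pointwise. Write `k_b = p_b² − T`,
`A = ⟨g, k_0⟩_{μ_T}`, `B = ⟨g, k_{L−1}⟩_{μ_T}` and `G = γ(1 − (γ/T²) A)` (the Kubo conductance; by the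
mixing-free Kubo link it is `D_L/(L−1)` along the unique flip-steady family).

* `integral_mul_flipNoise_self` — the flip Dirichlet form: `⟨g, S g⟩_μ = −½ Σ_i ‖g∘F_i − g‖²_μ ≤ 0` for every
  flip-invariant `μ` and `g ∈ L²(μ)`.
* `flip_forwardPair` — the reduction: `g` is an `ε = 0` forward PAIR for the modified source
  `k' = k_0 + ε S g ∈ L²(μ_T)` (`X_H g + γ S_B g = −k'`), so the landed Kubo toolkit of crux 11748
  (`memLp_partialP`, `fluctuation_dissipation`, `cross`/`integral_cross_eq`, Gaussian IBP) applies verbatim.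
* `flip_rowSum` — **`A + B = T²/γ`** at every `ε` (cross Green identity against the backward pair
  `(H, γ(k_0 + k_{L−1}))`, `S H = 0`, `S` symmetric under `μ_T`, equipartition).
* `helper_flipRowSum` — registered helper (notation-free restatement of `flip_rowSum`).
The companion file `…FlipKuboOnsager.lean` proves `0 < G ≤ γ`.

References: Bonetto–Lebowitz–Rey-Bellet 2000, eq. (32); Rey-Bellet 2003, Rem. 4.4; Bernardin–Olla 2011 §2.1
(`S` symmetric, non-positive); Eckmann–Pillet–Rey-Bellet 1999 §3; folklore (second law at linear response).
-/

noncomputable section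

open MeasureTheory Filter Topology
open scoped ContDiff
open Literature.MathematicalPhysics.KineticTheory.HeatConduction
open Summit.AtomisticToContinuum.FouriersLaw.Theorems.SuperadditiveResistance.DeviceLiouville
  (kin kin_eq_sq liouvilleOp bathOp)
open Summit.AtomisticToContinuum.FouriersLaw.Theorems.SuperadditiveResistance.Kubo
  (termWeight termWeight_nonneg termWeight_pos sum_termWeight_mul memLp_partialP fluctuation_dissipation
    memLp_kinetic memLp_hamiltonian partition_pos integrable_mul_gibbsDensity_iff integrable_mul_mul_gibbsDensity
    integrable_sq_mul_gibbsDensity)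
open Summit.AtomisticToContinuum.FouriersLaw.Theorems.SuperadditiveResistance.KuboPlain
  (plainForwardFields plainKubo plainKubo_pos generator_eq_liouvilleOp_add_bathOp bathFin bathFin_zero bathFin_one
    bathFin_injective bathWeight_eq_termWeight)
open Summit.AtomisticToContinuum.FouriersLaw.Cruxes.SuperadditiveResistance.FloatingProbeBypassLaplacian
  (pinnedChain_memLp_two_snd pinnedChain_memLp_two_snd_sq pinnedChain_integral_snd_sq
    integral_mul_sq_sub_gibbsMeasure)
open Summit.AtomisticToContinuum.FouriersLaw.Cruxes.ConductanceLowerBound.ForecastSensitivity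
  (integral_cross_eq liouvilleOp_hamiltonian bathOp_bathWeight_hamiltonian)

namespace Summit.AtomisticToContinuum.FouriersLaw.Theorems.VanishingNoiseBound

/-! ## The flip Dirichlet form -/

section FlipDirichlet

variable {N : ℕ} {μ : Measure (PhaseSpace N)}

/-- `g ∘ F_i ∈ L²(μ)` for a flip-invariant `μ` and `g ∈ L²(μ)`. [folklore] -/
theorem memLp_comp_momentumFlip (hμ : ∀ i, MeasurePreserving (momentumFlip i) μ μ) {g : PhaseSpace N → ℝ}
    (hg : MemLp g 2 μ) (i : Fin N) : MemLp (fun x => g (momentumFlip i x)) 2 μ :=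
  hg.comp_measurePreserving (hμ i)

/-- `S g ∈ L²(μ)` for a flip-invariant `μ` and `g ∈ L²(μ)`. [folklore] -/
theorem memLp_flipNoise (hμ : ∀ i, MeasurePreserving (momentumFlip i) μ μ) {g : PhaseSpace N → ℝ}
    (hg : MemLp g 2 μ) : MemLp (flipNoise N g) 2 μ := by
  have h : flipNoise N g = fun x => ∑ i, (g (momentumFlip i x) - g x) := funext fun x => flipNoise_eq N g x
  rw [h]
  exact memLp_finsetSum _ fun i _ => (memLp_comp_momentumFlip hμ hg i).sub hg

/-- **The flip Dirichlet form.** For a flip-invariant measure `μ` and `g ∈ L²(μ)`: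
`∫ g · S g dμ = −½ Σ_i ∫ (g∘F_i − g)² dμ` (so `−S` is a non-negative symmetric form; Bernardin–Olla 2011 §2.1).
[cite: BernardinOlla2011, §2.1] -/
theorem integral_mul_flipNoise_self (hμ : ∀ i, MeasurePreserving (momentumFlip i) μ μ) {g : PhaseSpace N → ℝ}
    (hg : MemLp g 2 μ) :
    ∫ x, g x * flipNoise N g x ∂μ = -(1 / 2) * ∑ i, ∫ x, (g (momentumFlip i x) - g x) ^ 2 ∂μ := by
  have hgi : ∀ i, MemLp (fun x => g (momentumFlip i x)) 2 μ := memLp_comp_momentumFlip hμ hg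
  have hgg : Integrable (fun x => g x * g x) μ := hg.integrable_mul hg
  have hggi : ∀ i, Integrable (fun x => g x * g (momentumFlip i x)) μ := fun i => hg.integrable_mul (hgi i)
  have hgigi : ∀ i, Integrable (fun x => g (momentumFlip i x) * g (momentumFlip i x)) μ := fun i =>
    (hgi i).integrable_mul (hgi i)
  -- `∫ (g∘F_i)² = ∫ g²`
  have hsq : ∀ i, ∫ x, g (momentumFlip i x) * g (momentumFlip i x) ∂μ = ∫ x, g x * g x ∂μ := fun i =>
    integral_comp_momentumFlip (hμ i) (fun x => g x * g x)
  have hterm : ∀ i, ∫ x, g x * (g (momentumFlip i x) - g x) ∂μ =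
      -(1 / 2) * ∫ x, (g (momentumFlip i x) - g x) ^ 2 ∂μ := by
    intro i
    have e1 : (fun x => g x * (g (momentumFlip i x) - g x)) = fun x => g x * g (momentumFlip i x) - g x * g x := by
      funext x; ring
    have e2 : (fun x => (g (momentumFlip i x) - g x) ^ 2) =
        fun x => g (momentumFlip i x) * g (momentumFlip i x) - 2 * (g x * g (momentumFlip i x)) + g x * g x := by
      funext x; ring
    have I2 : Integrable (fun x => 2 * (g x * g (momentumFlip i x))) μ := (hggi i).const_mul 2
    have I1 : Integrable (fun x => g (momentumFlip i x) * g (momentumFlip i x) - 2 * (g x * g (momentumFlip i x))) μ :=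
      (hgigi i).sub I2
    rw [e1, e2, integral_sub (hggi i) hgg, integral_add I1 hgg, integral_sub (hgigi i) I2, integral_const_mul, hsq i]
    ring
  have e : (fun x => g x * flipNoise N g x) = fun x => ∑ i, g x * (g (momentumFlip i x) - g x) := by
    funext x; rw [flipNoise_eq, Finset.mul_sum]
  rw [e, integral_finsetSum _ fun i _ => ?_, Finset.mul_sum]
  · exact Finset.sum_congr rfl fun i _ => hterm i
  · have : (fun x => g x * (g (momentumFlip i x) - g x)) = fun x => g x * g (momentumFlip i x) - g x * g x := by
      funext x; ring
    rw [this]; exact (hggi i).sub hgg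

/-- The flip Dirichlet energy is non-negative. [folklore] -/
theorem flipDirichlet_nonneg (g : PhaseSpace N → ℝ) :
    0 ≤ ∑ i, ∫ x, (g (momentumFlip i x) - g x) ^ 2 ∂μ :=
  Finset.sum_nonneg fun _ _ => integral_nonneg fun _ => sq_nonneg _

end FlipDirichlet

/-! ## A flip forward field is an `ε = 0` forward pair for the source `k_0 + ε S g` -/

section Pair

variable {ω₂ lam β γ : ℝ}

/-- The flip generator in pair form at equal temperatures: `L_{T,T} f + εSf = X_H f + γ S_{bathWeight} f + ε S f`. [folklore] -/
theorem flipGenerator_eq_pair (L : ℕ) (T ε : ℝ) (f : PhaseSpace L → ℝ) (x : PhaseSpace L) :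
    (pinnedChain ω₂ lam β γ).flipGenerator L T T ε f x =
      liouvilleOp (pinnedChain ω₂ lam β γ) L f x + γ * bathOp L (OscillatorChain.bathWeight L) T f x + ε * flipNoise L f x := by
  rw [OscillatorChain.flipGenerator_eq_add_flipNoise, generator_eq_liouvilleOp_add_bathOp]
  rfl

/-- **The reduction.** If `(L_{T,T} + εS) g = −k` pointwise then `(g, k + εSg)` is a forward pair of the plain
equilibrium generator: `1·X_H g + γ S_B g = −(k + ε S g)` with `B = bathWeight`. [folklore] -/
theorem flip_forwardPair (L : ℕ) (T ε : ℝ) {g k : PhaseSpace L → ℝ}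
    (hpde : ∀ x, (pinnedChain ω₂ lam β γ).flipGenerator L T T ε g x = -k x) (x : PhaseSpace L) :
    1 * liouvilleOp (pinnedChain ω₂ lam β γ) L g x + γ * bathOp L (OscillatorChain.bathWeight L) T g x = -(k x + ε * flipNoise L g x) := by
  have h := hpde x
  rw [flipGenerator_eq_pair] at h
  linarith

/-- The Gibbs measure of the pinned chain is flip invariant (restated). [folklore] -/
theorem gibbs_flipInvariant (L : ℕ) (T : ℝ) :
    ∀ i, MeasurePreserving (momentumFlip i) ((pinnedChain ω₂ lam β γ).gibbsMeasure L T) ((pinnedChain ω₂ lam β γ).gibbsMeasure L T) :=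
  fun i => (pinnedChain ω₂ lam β γ).measurePreserving_momentumFlip_gibbsMeasure L T i

end Pair

/-! ## The energy row sum at every flip rate -/

section RowSum

variable {ω₂ lam β γ : ℝ}

/-- **Energy row sum of a flip forward field: `⟨g, p_0² − T⟩_{μ_T} + ⟨g, p_{L−1}² − T⟩_{μ_T} = T²/γ`** for every
classical `C² ∩ L²(μ_T)` solution of `(L_{T,T} + εS) g = −(p_0² − T)`, `L ≥ 2`, any `ε : ℝ`. Proof: the cross Green
identity (`integral_cross_eq`, crux 11749) for the forward pair `(g, k_0 + εSg)` against the backward pair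
`(H, γ(k_0 + k_{L−1}))`, then `⟨H, Sg⟩ = ⟨SH, g⟩ = 0` (`S` symmetric under `μ_T`, `S H = 0`) and
`⟨H, k_0⟩_{μ_T} = T⟨p_0, p_0⟩ = T²`. -/
theorem flip_rowSum (hω : 0 < ω₂) (hl : 0 < lam) (hβ : 0 < β) (hγ : 0 < γ) {T : ℝ} (hT : 0 < T) (ε : ℝ)
    {L : ℕ} (hL : 2 ≤ L) {g : PhaseSpace L → ℝ} (hg2 : ContDiff ℝ 2 g)
    (hgL : MemLp g 2 ((pinnedChain ω₂ lam β γ).gibbsMeasure L T))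
    (hpde : ∀ x, (pinnedChain ω₂ lam β γ).flipGenerator L T T ε g x = -(kin L 0 x - T)) :
    (∫ x, g x * (kin L 0 x - T) ∂((pinnedChain ω₂ lam β γ).gibbsMeasure L T)) +
      ∫ x, g x * (kin L (L - 1) x - T) ∂((pinnedChain ω₂ lam β γ).gibbsMeasure L T) = T ^ 2 / γ := by
  have hL0 : 0 < L := by omega
  have hL1 : L - 1 < L := by omega
  set μ := (pinnedChain ω₂ lam β γ).gibbsMeasure L T with hμdef
  set H := (pinnedChain ω₂ lam β γ).hamiltonian L with hHdef
  set B := OscillatorChain.bathWeight L with hB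
  haveI : IsProbabilityMeasure μ := pinnedChain_isProbabilityMeasure_gibbsMeasure hω hl.le hβ.le γ L hT
  have hflip := gibbs_flipInvariant (ω₂ := ω₂) (lam := lam) (β := β) (γ := γ) L T
  -- regularity of `H`
  have hHs : ContDiff ℝ ∞ H :=
    (pinnedChain ω₂ lam β γ).contDiff_hamiltonian (pinnedChain_contDiff_U ω₂ lam β γ) (pinnedChain_contDiff_V ω₂ lam β γ) L
  have hH2 : ContDiff ℝ 2 H := hHs.of_le (by norm_cast)
  have hHd : Differentiable ℝ H := hH2.differentiable two_ne_zero
  -- square integrability of the players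
  have hHL2 : MemLp H 2 μ := memLp_hamiltonian (γ := γ) hω hl.le hβ.le L hT
  have hkinL2 : ∀ {s : ℕ}, s < L → MemLp (fun x => kin L s x - T) 2 μ := fun {s} hs =>
    ((pinnedChain_memLp_two_snd_sq hω hl.le hβ.le γ L hT ⟨s, hs⟩).sub (memLp_const T)).ae_eq
      (ae_of_all _ fun x => by simp [kin_eq_sq hs])
  have hk0L2 : MemLp (fun x => kin L 0 x - T) 2 μ := hkinL2 hL0
  have hkRL2 : MemLp (fun x => kin L (L - 1) x - T) 2 μ := hkinL2 hL1
  have hkHL2 : MemLp (fun x => γ * ((kin L 0 x - T) + (kin L (L - 1) x - T))) 2 μ :=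
    (hk0L2.add hkRL2).const_mul γ
  have hSgL2 : MemLp (flipNoise L g) 2 μ := memLp_flipNoise hflip hgL
  set k' : PhaseSpace L → ℝ := fun x => (kin L 0 x - T) + ε * flipNoise L g x with hk'
  have hk'L2 : MemLp k' 2 μ := hk0L2.add (hSgL2.const_mul ε)
  -- the two pairs
  have hB0 : ∀ i, 0 ≤ B i := by
    intro i
    simp only [hB, OscillatorChain.bathWeight]
    positivity
  have hpg : ∀ x, 1 * liouvilleOp (pinnedChain ω₂ lam β γ) L g x + γ * bathOp L B T g x = -k' x := fun x =>
    flip_forwardPair (ω₂ := ω₂) (lam := lam) (β := β) (γ := γ) L T ε (k := fun y => kin L 0 y - T) hpde x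
  have hpH : ∀ x, -1 * liouvilleOp (pinnedChain ω₂ lam β γ) L H x + γ * bathOp L B T H x =
      -(γ * ((kin L 0 x - T) + (kin L (L - 1) x - T))) := by
    intro x
    rw [liouvilleOp_hamiltonian, bathOp_bathWeight_hamiltonian (pinnedChain ω₂ lam β γ) hL0]
    ring
  -- the cross identity, cutoff removed, in Gibbs-measure form
  have hρeq : ∫ x, H x * k' x * (pinnedChain ω₂ lam β γ).gibbsDensity L T x =
      ∫ x, g x * (γ * ((kin L 0 x - T) + (kin L (L - 1) x - T))) * (pinnedChain ω₂ lam β γ).gibbsDensity L T x :=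
    integral_cross_eq hω hl.le hβ.le L hT B hB0 1 hγ hg2 hH2 hgL hk'L2 hHL2 hkHL2 hpg hpH
  have hμeq : ∫ x, g x * (γ * ((kin L 0 x - T) + (kin L (L - 1) x - T))) ∂μ = ∫ x, H x * k' x ∂μ := by
    rw [(pinnedChain ω₂ lam β γ).integral_gibbsMeasure, (pinnedChain ω₂ lam β γ).integral_gibbsMeasure, hρeq]
  -- `⟨H, k'⟩ = ⟨H, k_0⟩ + ε⟨H, Sg⟩ = T² + 0`
  have hHk0 : ∫ x, H x * (kin L 0 x - T) ∂μ = T ^ 2 := by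
    have hdH : ∀ x, partialP (⟨0, hL0⟩ : Fin L) H x = x.2 ⟨0, hL0⟩ := fun x => (pinnedChain ω₂ lam β γ).partialP_hamiltonian L x _
    have hdHL2 : MemLp (partialP (⟨0, hL0⟩ : Fin L) H) 2 μ := by
      rw [show partialP (⟨0, hL0⟩ : Fin L) H = fun x => x.2 ⟨0, hL0⟩ from funext hdH]
      exact pinnedChain_memLp_two_snd hω hl.le hβ.le γ L hT _
    have e1 : ∫ x, H x * (kin L 0 x - T) ∂μ = ∫ x, H x * (x.2 ⟨0, hL0⟩ ^ 2 - T) ∂μ :=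
      integral_congr_ae (ae_of_all _ fun x => by dsimp only; rw [kin_eq_sq hL0])
    have e2 : ∫ x, partialP (⟨0, hL0⟩ : Fin L) H x * x.2 ⟨0, hL0⟩ ∂μ = ∫ x, x.2 ⟨0, hL0⟩ ^ 2 ∂μ :=
      integral_congr_ae (ae_of_all _ fun x => by dsimp only; rw [hdH x]; ring)
    rw [e1, integral_mul_sq_sub_gibbsMeasure hω hl.le hβ.le γ L hT ⟨0, hL0⟩ hHd hHL2 hdHL2, e2,
      pinnedChain_integral_snd_sq hω hl.le hβ.le γ L hT ⟨0, hL0⟩]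
    ring
  have hHS : ∫ x, H x * flipNoise L g x ∂μ = 0 := by
    have hgi : ∀ i, MemLp (fun x => g (momentumFlip i x)) 2 μ := memLp_comp_momentumFlip hflip hgL
    rw [integral_mul_flipNoise hflip (hHL2.integrable_mul hgL) (fun i => hHL2.integrable_mul (hgi i))]
    have h0 : flipNoise L H = fun _ => 0 := funext fun x => flipNoise_hamiltonian (pinnedChain ω₂ lam β γ) L x
    simp [h0]
  have hHk' : ∫ x, H x * k' x ∂μ = T ^ 2 := by
    have i1 : Integrable (fun x => H x * (kin L 0 x - T)) μ := hHL2.integrable_mul hk0L2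
    have i2 : Integrable (fun x => H x * flipNoise L g x) μ := hHL2.integrable_mul hSgL2
    have e : (fun x => H x * k' x) = fun x => H x * (kin L 0 x - T) + ε * (H x * flipNoise L g x) := by
      funext x; rw [hk']; ring
    rw [e, integral_add i1 (i2.const_mul ε), integral_const_mul, hHS, hHk0]
    ring
  -- split the pairing with `γ(k_0 + k_{L−1})`
  have hsplit : ∫ x, g x * (γ * ((kin L 0 x - T) + (kin L (L - 1) x - T))) ∂μ =
      γ * ((∫ x, g x * (kin L 0 x - T) ∂μ) + ∫ x, g x * (kin L (L - 1) x - T) ∂μ) := by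
    have i1 : Integrable (fun x => g x * (kin L 0 x - T)) μ := hgL.integrable_mul hk0L2
    have i2 : Integrable (fun x => g x * (kin L (L - 1) x - T)) μ := hgL.integrable_mul hkRL2
    rw [← integral_add i1 i2, ← integral_const_mul]
    exact integral_congr_ae (ae_of_all _ fun x => by ring)
  have hfin : γ * ((∫ x, g x * (kin L 0 x - T) ∂μ) + ∫ x, g x * (kin L (L - 1) x - T) ∂μ) = T ^ 2 := by
    rw [← hsplit, hμeq, hHk']
  rw [eq_div_iff hγ.ne']
  linear_combination hfin

end RowSum

/-! ## Registered helper -/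

/-- Registered helper sub-goal `helper_flipRowSum` of stub `stub_noisyPositiveConductance` (line
`fekete-usc-one-length`, crux stmt-AtomisticToContinuum-11976): the energy row sum
`⟨g, p_0² − T⟩_{μ_T} + ⟨g, p_{L−1}² − T⟩_{μ_T} = T²/γ` for every classical `C² ∩ L²(μ_T)` forward field `g` of the
flip-noisy equilibrium generator, `(L_{T,T} + εS) g = −(p_0² − T)` (`L ≥ 2`, any `ε`) (`flip_rowSum`). -/
theorem helper_flipRowSum : ∀ (ω₂ lam β γ T ε : ℝ), 0 < ω₂ → 0 < lam → 0 < β → 0 < γ → 0 < T → ∀ (L : ℕ), 2 ≤ L → ∀ g : Literature.MathematicalPhysics.KineticTheory.HeatConduction.PhaseSpace L → ℝ, ContDiff ℝ 2 g → MeasureTheory.MemLp g 2 ((Literature.MathematicalPhysics.KineticTheory.HeatConduction.pinnedChain ω₂ lam β γ).gibbsMeasure L T) → (∀ x, (Literature.MathematicalPhysics.KineticTheory.HeatConduction.pinnedChain ω₂ lam β γ).flipGenerator L T T ε g x = -(Summit.AtomisticToContinuum.FouriersLaw.Theorems.SuperadditiveResistance.DeviceLiouville.kin L 0 x - T)) →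 MeasureTheory.integral ((Literature.MathematicalPhysics.KineticTheory.HeatConduction.pinnedChain ω₂ lam β γ).gibbsMeasure L T) (fun x => g x * (Summit.AtomisticToContinuum.FouriersLaw.Theorems.SuperadditiveResistance.DeviceLiouville.kin L 0 x - T)) + MeasureTheory.integral ((Literature.MathematicalPhysics.KineticTheory.HeatConduction.pinnedChain ω₂ lam β γ).gibbsMeasure L T) (fun x => g x * (Summit.AtomisticToContinuum.FouriersLaw.Theorems.SuperadditiveResistance.DeviceLiouville.kin L (L - 1) x - T)) = T ^ 2 / γ :=
  fun _ _ _ _ _ ε hω hl hβ hγ hT _ hL _ hg2 hgL hpde => flip_rowSum hω hl hβ hγ hT ε hL hg2 hgL hpde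

end Summit.AtomisticToContinuum.FouriersLaw.Theorems.VanishingNoiseBound

end
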